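import Literature.NumberTheory.EllipticCurves.Buyukboduk2009.KuriharaNumberTamagawaDivisibility
import Summits.BirchSwinnertonDyer.Rank1Residual.Supersingular.KobayashiMainConjectureKuriharaRigidity
import Literature.NumberTheory.EllipticCurves.BSDSelmerPConverseSerreProofs
import Literature.NumberTheory.EllipticCurves.Rank1Residual.Typed.X7
import HarnessLib

/-!
# Route `SignedLowerHalves`, crux 3 `KobayashiLowerHalfLargeImage` (item stmt-BirchSwinnertonDyer-19001),
# line of record `kurihara_rigidity`: the registered `≥` stub `stub_tamagawa_le_kuriharaPartialInfty_X7`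
# on the ONE-CARRIER rows from PUBLISHED facts — Büyükboduk 2009 Thm. B ∘ Kim 2026 Thm. 3.13
# (cell `bsd-ssimc`, width seat `bsd-line-slh-p1-w2` gen 6; helper file `--supports 19001`)

HONEST FRAMING: the crux is OPEN and nothing here proves it for the class; BSD is not proved by any of
this. The registered stub `stub_tamagawa_le_kuriharaPartialInfty_X7` (the `≥` half
`ord_p ∏_ℓ c_ℓ ≤ ∂^{(∞)}(δ̃)` of Kim's Conjecture 1.10 on X7 ∧ ¬CM ∧ `a_p = 0` ∧ Surj ∧ `p ≥ 5`) is
closed in the tree only MODULO the PREPRINT reading `CastellaSano2026_sec2_tamagawaDefectGe_implicit_OPEN`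
(`KuriharaRigidity.tamagawa_le_kuriharaPartialInfty_X7`, p607714). In PRINT the contribution of ONE
Tamagawa number is a theorem: Büyükboduk, JNT 129 (2009) Thm. B / Cor. 3.3 (`κ^{Kato} ∈ p^{ord_p c_ℓ} KS(T)`)
composed with C.-H. Kim, AJM 148 (2026) Thm. 3.13 (`ι∘exp*∘loc^s_p(κ^{Kato}_n) = u·p^t·δ̃_n`) — the tree's
named fact `Buyukboduk2009.thmB_via_kim313_padicValNat_localTamagawa_le_kuriharaPartialInfty` (`hB`, PUB ∘ PUB,
flags in its module docstring). This file reads it on the stub's population: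

* `tamagawa_le_kuriharaPartialInfty_of_le_localTamagawa` (class-free): `p ≥ 5` good, `a_p = 0`, `ρ̄` onto,
  `f` a newform of `W`, a prime `ℓ ≠ p` with `ord_p ∏ c ≤ ord_p c_ℓ` ⟹ `ord_p ∏ c ≤ ∂^{(∞)}(δ̃)` — granted
  `hB` and the period fact `h5` (`realPeriodRat_eq_unit_mul_plusPeriod`); `(t0)` DISCHARGED by the tree
  theorem `natCard_localPTorsion_eq_one_of_good_of_not_dvd_frobeniusTrace_sub_one` (`a_p = 0`), `p`-adic
  surjectivity by Serre (`serre_hasSurjectiveModNGaloisRep_pow_holds`), irreducibility from surjectivity.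
* `KuriharaRigidity.tamagawa_le_kuriharaPartialInfty_X7_of_oneCarrier` — the registered stub's signature
  VERBATIM plus ONE per-pair hypothesis «`∃ ℓ ≠ p` prime with `ord_p ∏_ℓ c_ℓ(E) ≤ ord_p c_ℓ(E)`» (all the
  `p`-part of the Tamagawa product sits at a single bad prime — the generic `p ∣ Tam` row; decidable from
  Cremona/LMFDB local data): PRE → PUB on that sub-population.

WHAT IS NOT HERE: the rows with TWO OR MORE Tamagawa-`p` carriers (the SUM form: Büyükboduk §4.2 Questions
1–2, not in print; a Kolyvagin-system-only derivation is barred by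
`Literature.Barriers.BirchSwinnertonDyer.StringentKolyvaginCapsAtMax`) stay on the PRE binder; `p = 3`
untouched (B09 `p > 3`, K26 `p ≥ 5`); the `≤` half (the HARD stub) untouched. CALIBRATION / SUPPORT ONLY
(pen rule D34-4 (3)): a helper under the registered stub, not a by-name close.

References: [Buyukboduk2009TamagawaDefect] Thm. B, Cor. 3.3, §4.2; [Kim2022StructureSelmer] Thm. 3.13,
§3.2.1, Conj. 1.10; [SerreAbelianLadic1968] IV §3.4; [GreenbergVatsal2000] §3 Rem. 3.4 (period transfer).
-/

set_option autoImplicit false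
set_option linter.dupNamespace false

noncomputable section

open scoped Classical MatrixGroups ModularForm

open CongruenceSubgroup WeierstrassCurve Literature.NumberTheory.EllipticCurves
  Literature.NumberTheory.EllipticCurves.ModularForms Literature.NumberTheory.GaloisRepresentations
  Literature.NumberTheory.EllipticCurves.Rank1Residual Literature.NumberTheory.EllipticCurves.Rank1Residual.Typed
  Summit.BirchSwinnertonDyer.Rank1Residual.Supersingular

namespace Summit.BirchSwinnertonDyer.BirchSwinnertonDyer.Theorems.KuriharaRigidity

section OneCarrier

variable (W : WeierstrassCurve ℚ) [W.IsElliptic] [W.IsGloballyMinimal] (p : ℕ) [Fact p.Prime]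

/-- **`ord_p ∏_ℓ c_ℓ ≤ ∂^{(∞)}(δ̃)` when ONE bad prime carries the whole `p`-part of the Tamagawa product**
(class-free): `p ≥ 5` good with `a_p = 0`, `ρ̄_{E,p}` onto, `f` a newform of `E = W` (any level), and a
prime `ℓ ≠ p` with `ord_p ∏ c ≤ ord_p c_ℓ` (`c_ℓ = (W.baseChange ℚ_[ℓ]).localTamagawaNumber ℤ_[ℓ]`); granted
BY NAME the published composite `hB` (Büyükboduk 2009 Thm. B ∘ Kim 2026 Thm. 3.13: `ord_p c_ℓ ≤ ∂^{(∞)}(δ̃)`)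
and the period-transfer fact `h5`. The binders of `hB` are discharged: `p`-adic surjectivity by Serre
(`p ≥ 5`), `#E(ℚ_p)[p] = 1` by `a_p = 0` (`natCard_localPTorsion_eq_one_of_good_of_not_dvd_frobeniusTrace_sub_one`),
irreducibility (for `h5`) from surjectivity. CONDITIONAL on `hB`, `h5` (both PUBLISHED named facts).
[cite: Buyukboduk2009TamagawaDefect, Thm. B and Cor. 3.3 (arXiv:0710.3858 pp. 2, 11)]
[cite: Kim2022StructureSelmer, Thm. 3.13 (PDF p. 17)] [cite: SerreAbelianLadic1968, Ch. IV §3.4, Lemma 3]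
[cite: GreenbergVatsal2000, §3, Remark 3.4] -/
theorem tamagawa_le_kuriharaPartialInfty_of_le_localTamagawa
    (hB : Buyukboduk2009.thmB_via_kim313_padicValNat_localTamagawa_le_kuriharaPartialInfty)
    (h5 : realPeriodRat_eq_unit_mul_plusPeriod)
    (hp5 : 5 ≤ p) (hgood : W.HasGoodReductionAtPrime p) (hap : W.frobeniusTrace p = 0)
    (hs : W.HasSurjectiveModNGaloisRep p)
    {N : ℕ} [NeZero N] {f : CuspForm (Gamma0 N) 2} (hf : IsNewformOf W f)
    {ℓ : ℕ} [Fact ℓ.Prime] (hℓ : ℓ ≠ p)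
    (hle : padicValNat p W.tamagawaProduct ≤
      padicValNat p ((W.baseChange ℚ_[ℓ]).localTamagawaNumber ℤ_[ℓ])) :
    (padicValNat p W.tamagawaProduct : ℕ∞) ≤ kuriharaPartialInfty W p f := by
  have hpP : p.Prime := Fact.out
  -- the binders of `hB`
  have hsurj : ∀ m : ℕ, W.HasSurjectiveModNGaloisRep (p ^ m : ℕ) :=
    serre_hasSurjectiveModNGaloisRep_pow_holds W p hp5 hs
  have ht0 : Nat.card {Q : (W.baseChange ℚ_[p]).toAffine.Point // (p : ℕ) • Q = 0} = 1 := by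
    refine natCard_localPTorsion_eq_one_of_good_of_not_dvd_frobeniusTrace_sub_one W p (by omega) hgood ?_
    rw [hap, zero_sub, dvd_neg]
    exact_mod_cast hpP.not_dvd_one
  have hirr : W.HasIrreducibleModPGaloisRep p :=
    hasIrreducibleModPGaloisRep_of_hasSurjectiveModNGaloisRep W p hs
  have hper : ∃ u : ℚ, ‖(u : ℚ_[p])‖ = 1 ∧ W.realPeriodRat = u * plusPeriod f :=
    h5 W p hp5 hgood hirr f hf
  have hℓ' := hB W p f hp5 hgood hf hsurj ht0 hper ℓ inferInstance hℓ
  exact le_trans (by exact_mod_cast hle) hℓ'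

/-- **The registered `≥` stub `stub_tamagawa_le_kuriharaPartialInfty_X7` on the ONE-CARRIER rows, from
PUBLISHED facts.** Signature of the stub VERBATIM (`5 ≤ p`, `ClassX7 W p`, `¬ W.HasCM`, `a_p = 0`,
`Surj W p`, the newform `f` of level `N_E`) plus ONE per-pair hypothesis: some prime `ℓ ≠ p` carries the
whole `p`-part of the Tamagawa product, `ord_p ∏_q c_q ≤ ord_p c_ℓ`. Then
`(ord_p ∏ c : ℕ∞) ≤ kuriharaPartialInfty W p f` granted `hB` (Büyükboduk ∘ Kim, PUB) and `h5` — where the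
tree so far had only the PREPRINT reading `CastellaSano2026_sec2_tamagawaDefectGe_implicit_OPEN`
(`KuriharaRigidity.tamagawa_le_kuriharaPartialInfty_X7`). `ClassX7` and `¬CM` are displayed, not used
beyond good reduction. Rows with several carriers are NOT covered (sum form not in print; barrier
`StringentKolyvaginCapsAtMax`). [cite: Buyukboduk2009TamagawaDefect, Thm. B and Cor. 3.3 (arXiv:0710.3858 pp. 2, 11)]
[cite: Kim2022StructureSelmer, Thm. 3.13 (PDF p. 17) and Conj. 1.10 (PDF p. 8)] -/
theorem tamagawa_le_kuriharaPartialInfty_X7_of_oneCarrier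
    (hB : Buyukboduk2009.thmB_via_kim313_padicValNat_localTamagawa_le_kuriharaPartialInfty)
    (h5 : realPeriodRat_eq_unit_mul_plusPeriod) :
    ∀ (W : WeierstrassCurve ℚ) [W.IsElliptic] [W.IsGloballyMinimal] (p : ℕ) [Fact p.Prime],
      5 ≤ p → ClassX7 W p → ¬ W.HasCM → W.frobeniusTrace p = 0 → Surj W p →
      (∃ (ℓ : ℕ) (_ : Fact ℓ.Prime), ℓ ≠ p ∧
        padicValNat p W.tamagawaProduct ≤ padicValNat p ((W.baseChange ℚ_[ℓ]).localTamagawaNumber ℤ_[ℓ])) →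
      ∀ [NeZero (W.conductorNorm ℤ)] (f : CuspForm (Gamma0 (W.conductorNorm ℤ)) 2),
        IsNewformOf W f → (padicValNat p W.tamagawaProduct : ℕ∞) ≤ kuriharaPartialInfty W p f := by
  intro W _ _ p _ hp5 hX _hcm hap hs hone _ f hf
  obtain ⟨ℓ, _, hℓ, hle⟩ := hone
  exact tamagawa_le_kuriharaPartialInfty_of_le_localTamagawa W p hB h5 hp5 hX.1.1 hap hs hf hℓ hle

end OneCarrier

end Summit.BirchSwinnertonDyer.BirchSwinnertonDyer.Theorems.KuriharaRigidity

end
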